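import Summits.NavierStokesRegularity.NavierStokesRegularity.Theorems.StrainClockLocalCompositionsB
import HarnessLib

/-!
# StrainClockLocalClosers — S39: plate E2_S^w by name and ALL FIVE DOORS CLOSED BY NAME (§5)

P0-39 part 4 of 4: §5 (`strainThresholdWeightedOn_holds` over sfl p664793, `localStrainTameness_holds`, `penalisedClockLiouville_holds`, `forwardStrainSmoothing_holds`, `integratedClockNoStretching_holds`, `integratedClockLiouville_holds`) of nsreg-p1 g32's `r37/Sketch39.v2.lean` sha16 8afe3b1c706e6582 (ROUND-37 S39 «LocalStrainClock»
65850a92b7bcd814), every declaration byte-identical, order preserved; cut prepared by ns-s29-p2 g4 (planner's suggested split,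
compositions halved for the 400-line cap), `--supports stmt-NavierStokesRegularity-0056 --as helper`.  UNCONDITIONAL (no named-fact hypothesis).

HONEST FRAME: door family S39 «LocalStrainClock» = local / penalised / integrated strain-clock CRITERIA about HYPOTHETICAL blow-up
profiles; items 0056 `NoTypeII`, 10661 and NS regularity are NOT proved; nothing here is a route or a summit statement.
-/

noncomputable section

open MeasureTheory Set Function Filter Metric Real InnerProductSpace
open _root_.Topology
open scoped ENNReal NNReal RealInnerProductSpace ContDiff Laplacian Interval
open Literature.Analysis Literature.Analysis.FluidPDE
open Literature.Analysis.FluidPDE.VorticityDirectionDynamics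

set_option linter.dupNamespace false

namespace Summit.NavierStokesRegularity.NavierStokesRegularity.Theorems.StrainDoors

open Summit.NavierStokesRegularity.NavierStokesRegularity.Theorems.ArgmaxDoors

-- nested operator types (second derivatives)
set_option maxSynthPendingDepth 3
/-! ## §5 Closers -/

/-- **Plate E2_S^w «StrainThresholdWeightedOn» CLOSED BY NAME**: the text is p664793
`ArgmaxDoors.strainThresholdWeighted` (ns-sfl-p1 g5, `Theorems/StrainClockThresholdWeighted.lean`) with `strainQuad` /
`strainRateOn` folded (definitional unfolding). -/
theorem strainThresholdWeightedOn_holds : StrainThresholdWeightedOn := strainThresholdWeighted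

/-- **door C1 «LocalStrainTameness» CLOSED** (no hypothesis). -/
theorem localStrainTameness_holds : LocalStrainTameness :=
  localStrainTameness_of strainFrameOn_holds strainThresholdWeightedOn_holds

/-- **door C2 «PenalisedClockLiouville» CLOSED** (no hypothesis). -/
theorem penalisedClockLiouville_holds : PenalisedClockLiouville :=
  penalisedClockLiouville_of localStrainTameness_holds rigidMotion_holds

/-- **door C3 «ForwardStrainSmoothing» CLOSED** (no hypothesis). -/
theorem forwardStrainSmoothing_holds : ForwardStrainSmoothing :=
  forwardStrainSmoothing_of strainFrameOn_holds strainThresholdWeightedOn_holds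

/-- **door C4♮ «IntegratedClockNoStretching» CLOSED** (no hypothesis). -/
theorem integratedClockNoStretching_holds : IntegratedClockNoStretching :=
  integratedClockNoStretching_of strainFrameOn_holds strainThresholdOn_holds

/-- **door C4 «IntegratedClockLiouville» CLOSED** (no hypothesis). -/
theorem integratedClockLiouville_holds : IntegratedClockLiouville :=
  integratedClockLiouville_of integratedClockNoStretching_holds rigidMotion_holds

end Summit.NavierStokesRegularity.NavierStokesRegularity.Theorems.StrainDoors

end
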